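import Summits.Ventures.PercRepro.S1NullityCells

/-!
# PercRepro — THE KILL OF PAIRWISE DISJOINT TRIANGLES (p2, gen 23; SUBCLAIM-S1 §6.8)

S1Kill's Bonferroni kill charges every pair of triangles the overlap `C(n − 5, p − 5)` (two triangles cover `≥ 5`
points). Two DISJOINT triangles cover `6` points and overlap in only `C(n − 6, p − 6)` `p`-sets — at `(10, 6)`
`210` against `462`. With the chain's pairwise disjoint subfamily (S1ChainCq) this is the kill of the cells at small
corank: `midCount_ge_K7_kill_gen` is `midCount_ge_K7_kill` with the pairwise cover `c` as a parameter, and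
`cellYsum_kill_le_gen`, `weighted_of_killnullOK_gen` are its consumers (S1KillCells, S1NullityCells with `c`).
Axioms: standard.
-/

open scoped Matroid

namespace PercRepro

namespace S1

open Set

variable {α : Type}

/-- **THE KILL LEVER WITH A GENERAL OVERLAP** (S1Kill's `midCount_ge_K7_kill` with the pairwise cover `c` in place of
`5`): for `m` distinct circuits `𝒯` of size `k ≤ p` of a core with (C1)–(C3), pairwise covering `≥ c ≤ p` points,
`7560·(Σ_{j=5}^{p−1} C(n, j) + m·C(n − k, p − k)) ≤ 7560·#Y(p, 4) + R₃ + R₄ + 7560·C(m, 2)·C(n − c, p − c)` — the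
`p`-supersets of two of the circuits overlap in `≤ C(n − c, p − c)` sets. Pairwise DISJOINT triangles have `c = 6`. -/
theorem midCount_ge_K7_kill_gen (M : Matroid α) [M.Finite]
    (hcirc : ∀ C, M.IsCircuit C → 3 ≤ C.encard)
    (hline : ∀ L ⊆ M.E, M.eRk L ≤ 2 → L.ncard ≤ 3) (hplane : ∀ P ⊆ M.E, M.eRk P ≤ 3 → P.ncard ≤ 6)
    (hten : ∀ X ⊆ M.E, M.eRk X ≤ 4 → X.ncard ≤ 10) {d : ℕ} (hd : M.E.encard = M.eRank + d) (p : ℕ) (hp : 5 ≤ p)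
    (k : ℕ) (hkp : k ≤ p) (c : ℕ) (hcp : c ≤ p) (𝒯 : Finset (Set α)) (h𝒯 : ∀ C ∈ 𝒯, M.IsCircuit C ∧ C.ncard = k)
    (hpair : ∀ C ∈ 𝒯, ∀ C' ∈ 𝒯, C ≠ C' → c ≤ (C ∪ C').ncard) :
    7560 * (∑ j ∈ Finset.Ico 5 p, M.E.ncard.choose j + 𝒯.card * (M.E.ncard - k).choose (p - k)) ≤
      7560 * Matroid.midCount M p 4 +
      10584 * ({C : Set α | M.IsCircuit C ∧ C.ncard = 3}.ncard * (M.E.ncard - 3) +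
        {C : Set α | M.IsCircuit C ∧ C.ncard = 4}.ncard) +
      (RSK 10 * ({C : Set α | M.IsCircuit C ∧ C.ncard = 3}.ncard * (M.E.ncard - 3).choose 2 +
        {C : Set α | M.IsCircuit C ∧ C.ncard = 4}.ncard * (M.E.ncard - 4) +
        {C : Set α | M.IsCircuit C ∧ C.ncard = 5}.ncard) +
      (RBK 10 - RSK 10) * ({C : Set α | M.IsCircuit C ∧ C.ncard = 3}.ncard * (min (5 * d) M.E.ncard - 3).choose 2 +
        {C : Set α | M.IsCircuit C ∧ C.ncard = 4}.ncard * (min (5 * d) M.E.ncard - 4) +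
        {C : Set α | M.IsCircuit C ∧ C.ncard = 5}.ncard)) +
      7560 * (𝒯.card.choose 2 * (M.E.ncard - c).choose (p - c)) := by
  classical
  have hY3 := five_mul_ncard_rankLe3_ge_five_le M hcirc hline hplane
  have hY2 := ncard_rankEq4_ge_five_le_K M hcirc hline hplane hten hd
  have hEfin : M.E.Finite := M.ground_finite
  set Ef := hEfin.toFinset with hEf
  -- the sets with `5 ≤ |A| ≤ p − 1`
  set 𝓑 : ℕ → Finset (Set α) := fun j => (Ef.powersetCard j).image (fun s : Finset α => (s : Set α)) with h𝓑
  have h𝓑card : ∀ j, (𝓑 j).card = M.E.ncard.choose j := fun j => by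
    rw [h𝓑]; exact card_image_powersetCard hEfin j
  have hmem𝓑 : ∀ j A, A ∈ 𝓑 j ↔ A ⊆ M.E ∧ A.ncard = j := fun j A =>
    mem_image_powersetCard_iff hEfin j A
  have hdisj : ((Finset.Ico 5 p : Finset ℕ) : Set ℕ).PairwiseDisjoint 𝓑 := by
    intro i _ j _ hij
    rw [Function.onFun, Finset.disjoint_left]
    intro A hA hA'
    rw [hmem𝓑] at hA hA'
    exact hij (hA.2.symm.trans hA'.2)
  set W := (Finset.Ico 5 p).biUnion 𝓑 with hW
  have hWcard : W.card = ∑ j ∈ Finset.Ico 5 p, M.E.ncard.choose j := by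
    rw [hW, Finset.card_biUnion hdisj]
    exact Finset.sum_congr rfl (fun j _ => h𝓑card j)
  have hmemW : ∀ A ∈ W, A ⊆ M.E ∧ 5 ≤ A.ncard ∧ A.ncard < p := by
    intro A hA
    rw [hW, Finset.mem_biUnion] at hA
    obtain ⟨j, hj, hAj⟩ := hA
    rw [Finset.mem_Ico] at hj
    rw [hmem𝓑] at hAj
    exact ⟨hAj.1, by omega, by omega⟩
  -- the kill: the `p`-sets through the triangles of `𝒯`
  set Kf : Set α → Finset (Set α) := fun C => oversets hEfin C (p - k) with hKf
  set KK := 𝒯.biUnion Kf with hKK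
  have hmemK : ∀ A ∈ KK, A ⊆ M.E ∧ A.ncard = p ∧ ∃ C ∈ 𝒯, C ⊆ A := by
    intro A hA
    rw [hKK, Finset.mem_biUnion] at hA
    obtain ⟨C, hC, hAC⟩ := hA
    have hCE : C ⊆ M.E := (h𝒯 C hC).1.subset_ground
    have hcard := ncard_of_mem_oversets hEfin hCE (p - k) hAC
    rw [hKf] at hAC
    rw [mem_oversets hEfin hCE] at hAC
    refine ⟨hAC.2.1, ?_, C, hC, hAC.1⟩
    rw [hcard, (h𝒯 C hC).2]
    omega
  have hKcard : 𝒯.card * (M.E.ncard - k).choose (p - k) ≤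
      KK.card + 𝒯.card.choose 2 * (M.E.ncard - c).choose (p - c) := by
    refine mul_le_card_biUnion_add_choose_two_mul 𝒯 Kf _ _ ?_ ?_
    · intro C hC
      have hCE : C ⊆ M.E := (h𝒯 C hC).1.subset_ground
      rw [hKf]
      simp only
      rw [card_oversets hEfin hCE, (h𝒯 C hC).2]
    · intro C hC C' hC' hne
      have hCE : C ⊆ M.E := (h𝒯 C hC).1.subset_ground
      have hC'E : C' ⊆ M.E := (h𝒯 C' hC').1.subset_ground
      have h5 := hpair C hC C' hC' hne
      obtain ⟨X, hXsub, hX5⟩ := Set.exists_subset_card_eq h5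
      have hXE : X ⊆ M.E := hXsub.trans (Set.union_subset hCE hC'E)
      have hsub : Kf C ∩ Kf C' ⊆ oversets hEfin X (p - c) := by
        intro Q hQ
        rw [Finset.mem_inter] at hQ
        have hQ1 := hQ.1
        have hQcard := ncard_of_mem_oversets hEfin hCE (p - k) hQ.1
        rw [hKf] at hQ
        simp only at hQ
        rw [mem_oversets hEfin hCE] at hQ
        have hQ2 := hQ.2
        rw [mem_oversets hEfin hC'E] at hQ2
        rw [mem_oversets hEfin hXE]
        refine ⟨hXsub.trans (Set.union_subset hQ.1.1 hQ2.1), hQ.1.2.1, ?_⟩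
        have hQfin : Q.Finite := hEfin.subset hQ.1.2.1
        have hXQ : X ⊆ Q := hXsub.trans (Set.union_subset hQ.1.1 hQ2.1)
        rw [Set.ncard_sdiff hXQ (hQfin.subset hXQ), hQcard, (h𝒯 C hC).2, hX5]
        omega
      calc (Kf C ∩ Kf C').card ≤ (oversets hEfin X (p - c)).card := Finset.card_le_card hsub
        _ = (M.E.ncard - c).choose (p - c) := by rw [card_oversets hEfin hXE, hX5]
  -- `W ∪ KK ⊆ Y ∪ T₃ ∪ T₄`, and `W`, `KK` are disjoint (sizes `< p` versus `= p`)
  set Y := {A : Set α | A ⊆ M.E ∧ (4 : ℕ∞) < M.eRk A ∧ M.eRk A < (p : ℕ∞)} with hY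
  set T₃ := {A : Set α | A ⊆ M.E ∧ M.eRk A ≤ 3 ∧ 5 ≤ A.ncard} with hT₃
  set T₄ := {A : Set α | A ⊆ M.E ∧ M.eRk A = 4 ∧ 5 ≤ A.ncard} with hT₄
  have hclass : ∀ A, A ⊆ M.E → 5 ≤ A.ncard → M.eRk A < (p : ℕ∞) → A ∈ Y ∪ T₃ ∪ T₄ := by
    intro A hAE h5 hlt
    by_cases h4 : (4 : ℕ∞) < M.eRk A
    · exact Or.inl (Or.inl ⟨hAE, h4, hlt⟩)
    · push Not at h4
      rcases h4.lt_or_eq with h | h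
      · have h3 : M.eRk A ≤ 3 := by
          have : M.eRk A < (3 : ℕ∞) + 1 := by rw [show ((3 : ℕ∞) + 1) = 4 by norm_num]; exact h
          simpa using Order.le_of_lt_add_one this
        exact Or.inl (Or.inr ⟨hAE, h3, h5⟩)
      · exact Or.inr ⟨hAE, h, h5⟩
  have hsub : ((W ∪ KK : Finset (Set α)) : Set (Set α)) ⊆ Y ∪ T₃ ∪ T₄ := by
    intro A hA
    rw [Finset.mem_coe, Finset.mem_union] at hA
    rcases hA with hA | hA
    · obtain ⟨hAE, h5, hlt⟩ := hmemW A hA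
      have hAfin : A.Finite := hEfin.subset hAE
      refine hclass A hAE h5 ?_
      calc M.eRk A ≤ A.encard := M.eRk_le_encard A
        _ = (A.ncard : ℕ∞) := hAfin.cast_ncard_eq.symm
        _ < (p : ℕ∞) := by exact_mod_cast hlt
    · obtain ⟨hAE, hAp, C, hC, hCA⟩ := hmemK A hA
      exact hclass A hAE (by omega) (eRk_lt_of_circuit_subset M (h𝒯 C hC).1 hCA hAE hAp)
  have hWK : Disjoint W KK := by
    rw [Finset.disjoint_left]
    intro A hAW hAK
    have h1 := (hmemW A hAW).2.2
    have h2 := (hmemK A hAK).2.1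
    omega
  have hYfin : Y.Finite := hEfin.finite_subsets.subset (fun A hA => hA.1)
  have hT₃fin : T₃.Finite := hEfin.finite_subsets.subset (fun A hA => hA.1)
  have hT₄fin : T₄.Finite := hEfin.finite_subsets.subset (fun A hA => hA.1)
  have hWle : W.card + KK.card ≤ Y.ncard + T₃.ncard + T₄.ncard := by
    calc W.card + KK.card = (W ∪ KK).card := (Finset.card_union_of_disjoint hWK).symm
      _ = ((W ∪ KK : Finset (Set α)) : Set (Set α)).ncard := (Set.ncard_coe_finset _).symm
      _ ≤ (Y ∪ T₃ ∪ T₄).ncard := Set.ncard_le_ncard hsub ((hYfin.union hT₃fin).union hT₄fin)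
      _ ≤ (Y ∪ T₃).ncard + T₄.ncard := Set.ncard_union_le _ _
      _ ≤ Y.ncard + T₃.ncard + T₄.ncard := by
          have := Set.ncard_union_le Y T₃
          omega
  have hmid : Matroid.midCount M p 4 = Y.ncard := rfl
  rw [← hWcard, hmid]
  have hY3' : 5 * T₃.ncard ≤ 7 * ({C : Set α | M.IsCircuit C ∧ C.ncard = 3}.ncard * (M.E.ncard - 3) +
      {C : Set α | M.IsCircuit C ∧ C.ncard = 4}.ncard) := hY3
  have hY2' : 7560 * T₄.ncard ≤ _ := hY2
  nlinarith [hWle, hY3', hY2', hKcard]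


/-- `cellYsum_kill_le` with the pairwise cover `c` (`C(n − c, p − c)` per pair of the family). -/
theorem cellYsum_kill_le_gen (M : Matroid α) [M.Finite] (p d P S S5 : ℕ) (hd4 : 4 ≤ d) (hR : M.eRank = (p : ℕ∞))
    (hn : M.E.ncard = p + d)
    (hfree : ∀ e ∈ M.E, ∃ A ⊆ M.E \ {e}, e ∉ M.closure A ∧ e ∉ M.closure ((M.E \ {e}) \ A))
    (hP : {C : Set α | M.IsCircuit C ∧ C.ncard = 3}.ncard ≤ P) (hS : {C : Set α | M.IsCircuit C ∧ C.ncard = 4}.ncard ≤ S)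
    (hS5 : {C : Set α | M.IsCircuit C ∧ C.ncard = 5}.ncard ≤ S5)
    (hp : 5 ≤ p) (k : ℕ) (hkp : k ≤ p) (c : ℕ) (hcp : c ≤ p) (𝒯 : Finset (Set α))
    (h𝒯 : ∀ C ∈ 𝒯, M.IsCircuit C ∧ C.ncard = k)
    (hpair : ∀ C ∈ 𝒯, ∀ C' ∈ 𝒯, C ≠ C' → c ≤ (C ∪ C').ncard) :
    cellYsum p d + 7560 * (𝒯.card * (p + d - k).choose (p - k)) ≤
      7560 * Matroid.midCount M p 4 + cellR34 p d P S S5 + 7560 * (𝒯.card.choose 2 * (p + d - c).choose (p - c)) := by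
  unfold cellR34 cellYsum
  simp only [CoreRegimes.chooseF_eq]
  classical
  have hL : ∀ e ∈ M.E, ¬ M.IsLoop e := ThmN.not_isLoop_of_free M hfree
  have hs : ∀ e ∈ M.E, ∀ f ∈ M.E, e ≠ f → M.eRk {e, f} = 2 := by
    intro e he f hf hef
    have h2 : (2 : ℕ∞) ≤ M.eRk {e, f} :=
      ThmN.two_le_eRk_of_two_le_ncard_of_free M hfree (pair_subset he hf) (by rw [ncard_pair hef])
    have h3 : M.eRk {e, f} ≤ 2 := by
      have := M.eRk_le_encard {e, f}
      rwa [encard_pair hef] at this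
    exact le_antisymm h3 h2
  have hcirc : ∀ C, M.IsCircuit C → 3 ≤ C.encard := ThmN.three_le_encard_of_circuit M hL hs
  have hline : ∀ L ⊆ M.E, M.eRk L ≤ 2 → L.ncard ≤ 3 := by
    intro L hL' hr
    have := ThmN.ncard_add_one_le_two_pow_of_eRk_le M hL hfree 2 L hL' hr
    omega
  have hplane : ∀ P ⊆ M.E, M.eRk P ≤ 3 → P.ncard ≤ 6 := fun P hP hr =>
    ThmN.ncard_le_six_of_eRk_le_three_of_free M hfree hP hr
  have hten : ∀ X ⊆ M.E, M.eRk X ≤ 4 → X.ncard ≤ 10 := fun X hX hr =>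
    ThmN.ncard_le_ten_of_eRk_le_four_of_free M hfree hX hr
  have hd : M.E.encard = M.eRank + d := by
    rw [hR, ← M.ground_finite.cast_ncard_eq, hn]
    push_cast
    ring
  set s3 := {C : Set α | M.IsCircuit C ∧ C.ncard = 3}.ncard with hs3
  set s4 := {C : Set α | M.IsCircuit C ∧ C.ncard = 4}.ncard with hs4
  set s5 := {C : Set α | M.IsCircuit C ∧ C.ncard = 5}.ncard with hs5
  have hb3 : s3 ≤ min (min (d * (d + 1) / 2) ((d * d + 6 - 3 * d) / 2)) P := by
    have h := two_mul_ncard_triangles_le M (fun L hL hr => hline L hL hr.le) hd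
    have h' : 2 * s3 ≤ d * (d + 1) := h
    have h2 := two_mul_ncard_triangles_add_three_mul_le_of_four_le M
      (fun L hL hr => hline L hL hr.le) hplane hd4 hd
    have h2' : 2 * s3 + 3 * d ≤ d * d + 6 := h2
    refine le_min (le_min ?_ ?_) hP
    · rw [Nat.le_div_iff_mul_le (by norm_num)]; omega
    · rw [Nat.le_div_iff_mul_le (by norm_num)]; omega
  have hb4 : s4 ≤ min (min (min ((d + 3).choose 4) (d * (d + 1) * (d + 2) / 3)) (fourCircuitBound d)) S := by
    refine le_min (le_min (le_min (ncard_circuits_four_le M hd) ?_) (ncard_fourCircuits_le_fourCircuitBound M hfree hd)) hS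
    have h := three_mul_ncard_four_circuits_le M hline hplane hd
    have h' : 3 * s4 ≤ d * (d + 1) * (d + 2) := h
    rw [Nat.le_div_iff_mul_le (by norm_num)]
    omega
  have hb5 : s5 ≤ min ((d + 4).choose 5) S5 := le_min (ncard_circuits_five_le M hd) hS5
  have hY := midCount_ge_K7_kill_gen M hcirc hline hplane hten hd p hp k hkp c hcp 𝒯 h𝒯 hpair
  rw [hn] at hY
  set m := min (5 * d) (p + d) with hm
  set s3B := min (min (d * (d + 1) / 2) ((d * d + 6 - 3 * d) / 2)) P with hs3B
  set s4B := min (min (min ((d + 3).choose 4) (d * (d + 1) * (d + 2) / 3)) (fourCircuitBound d)) S with hs4B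
  set s5B := min ((d + 4).choose 5) S5 with hs5B
  set piAll := s3 * (p + d - 3).choose 2 + s4 * (p + d - 4) + s5 with hpiAll
  set piS0 := s3 * (m - 3).choose 2 + s4 * (m - 4) + s5 with hpiS0
  set piAllB := s3B * (p + d - 3).choose 2 + s4B * (p + d - 4) + s5B with hpiAllB
  set piS0B := s3B * (m - 3).choose 2 + s4B * (m - 4) + s5B with hpiS0B
  have hpiAll_le : piAll ≤ piAllB := by
    rw [hpiAll, hpiAllB]; gcongr
  have hpiS0_le : piS0 ≤ piS0B := by
    rw [hpiS0, hpiS0B]; gcongr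
  have hR3_le : 10584 * (s3 * (p + d - 3) + s4) ≤ 10584 * (s3B * (p + d - 3) + s4B) := by
    gcongr
  have hR4_le : RSK 10 * piAll + (RBK 10 - RSK 10) * piS0 ≤ RSK 10 * piAllB + (RBK 10 - RSK 10) * piS0B := by
    gcongr
  have hY' : 7560 * (∑ j ∈ Finset.Ico 5 p, (p + d).choose j + 𝒯.card * (p + d - k).choose (p - k)) ≤
      7560 * Matroid.midCount M p 4 + 10584 * (s3 * (p + d - 3) + s4) +
      (RSK 10 * piAll + (RBK 10 - RSK 10) * piS0) +
      7560 * (𝒯.card.choose 2 * (p + d - c).choose (p - c)) := hY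
  omega


/-- `weighted_of_killnullOK` with the pairwise cover `c`: the kill `A + |𝒯|·C(n − k, p − k)` against the overlap
`B + C(|𝒯|, 2)·C(n − c, p − c)`. -/
theorem weighted_of_killnullOK_gen (N : Matroid α) [N.Finite] (p0 p d P S S5 A B X : ℕ) (hd4 : 4 ≤ d)
    (hR : N.eRank = (p : ℕ∞)) (hn : N.E.ncard = p + d)
    (hfree : ∀ e ∈ N.E, ∃ Z ⊆ N.E \ {e}, e ∉ N.closure Z ∧ e ∉ N.closure ((N.E \ {e}) \ Z))
    (hP : {C : Set α | N.IsCircuit C ∧ C.ncard = 3}.ncard ≤ P) (hS : {C : Set α | N.IsCircuit C ∧ C.ncard = 4}.ncard ≤ S)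
    (hS5 : {C : Set α | N.IsCircuit C ∧ C.ncard = 5}.ncard ≤ S5)
    (hp : 5 ≤ p) (hp0 : 5 ≤ p0) (k : ℕ) (hkp : k ≤ p) (c : ℕ) (hcp : c ≤ p) (𝒯 : Finset (Set α))
    (h𝒯 : ∀ C ∈ 𝒯, N.IsCircuit C ∧ C.ncard = k) (hpair : ∀ C ∈ 𝒯, ∀ C' ∈ 𝒯, C ≠ C' → c ≤ (C ∪ C').ncard)
    {Sn : Set α} (hSn : Sn ⊆ N.E) {r kk : ℕ} (hν : N.eRk Sn + (r : ℕ∞) ≤ (Sn.ncard : ℕ∞)) (hkk : d + 1 ≤ kk + r)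
    (hX : X ≤ {B : Set α | B ⊆ N.E ∧ B.ncard = 4 ∧ N.eRk B = 4 ∧ kk ≤ (B \ Sn).ncard}.ncard)
    (hok : killnullOK p0 p d P S S5 (A + 𝒯.card * (p + d - k).choose (p - k))
      (B + 𝒯.card.choose 2 * (p + d - c).choose (p - c)) X = true) :
    phiK p0 4 * (Matroid.topCount N p 4 : ℚ) + B ≤ (Matroid.midCount N p 4 : ℚ) + A := by
  have hd : N.E.encard = N.eRank + d := by
    rw [hR, ← N.ground_finite.cast_ncard_eq, hn]
    push_cast
    ring
  have hlevel := levelCount_le_cellUB N p d P S S5 hd4 hR hn hfree hP hS hS5 hp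
  have hexcl := topCount_add_excl_le N hR hd hn hd4 hSn hν hkk
  have hYB := cellYsum_kill_le_gen N p d P S S5 hd4 hR hn hfree hP hS hS5 hp k hkp c hcp 𝒯 h𝒯 hpair
  unfold killnullOK at hok
  simp only [CoreRegimes.chooseF_eq] at hok
  have hok' := of_decide_eq_true hok
  set phiNum := 2 ^ (p0 + 4) - 2 * ∑ u ∈ Finset.range 5, (p0 + 4).choose u with hphiNum
  set phiDen := (p0 + 4).choose 4 with hphiDen
  set UB := cellUB p d P S S5
  set R34 := cellR34 p d P S S5
  set Ysum := cellYsum p d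
  set T := Matroid.topCount N p 4
  set Y := Matroid.midCount N p 4
  set Z := {B : Set α | B ⊆ N.E ∧ B.ncard = 4 ∧ N.eRk B = 4 ∧ kk ≤ (B \ Sn).ncard}.ncard with hZ
  set L := {B : Set α | B ⊆ N.E ∧ N.eRk B = 4 ∧ B.ncard ≤ d}.ncard with hL
  set KA := 𝒯.card * (p + d - k).choose (p - k) with hKA
  set KB := 𝒯.card.choose 2 * (p + d - c).choose (p - c) with hKB
  -- `7560·T + 7560·X ≤ UB`
  have hUX : 7560 * T + 7560 * X ≤ UB := by
    have h1 : T + X ≤ L := by omega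
    calc 7560 * T + 7560 * X = 7560 * (T + X) := by ring
      _ ≤ 7560 * L := Nat.mul_le_mul_left _ h1
      _ ≤ UB := hlevel
  have h1 : phiNum * (7560 * T) + phiNum * (7560 * X) ≤ phiNum * UB := by
    calc phiNum * (7560 * T) + phiNum * (7560 * X) = phiNum * (7560 * T + 7560 * X) := by ring
      _ ≤ phiNum * UB := Nat.mul_le_mul_left _ hUX
  have h2 : phiDen * (Ysum + 7560 * KA) ≤ phiDen * (7560 * Y + R34 + 7560 * KB) := Nat.mul_le_mul_left _ hYB
  have hchain : phiNum * (7560 * T) + phiDen * (7560 * B) ≤ phiDen * (7560 * Y) + phiDen * (7560 * A) := by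
    have e1 : phiDen * (R34 + 7560 * (B + KB)) = phiDen * R34 + phiDen * (7560 * B) + phiDen * (7560 * KB) := by ring
    have e2 : phiDen * (Ysum + 7560 * (A + KA)) = phiDen * Ysum + phiDen * (7560 * A) + phiDen * (7560 * KA) := by ring
    have e3 : phiDen * (7560 * Y + R34 + 7560 * KB) = phiDen * (7560 * Y) + phiDen * R34 + phiDen * (7560 * KB) := by
      ring
    have e4 : phiDen * (Ysum + 7560 * KA) = phiDen * Ysum + phiDen * (7560 * KA) := by ring
    rw [e1, e2] at hok'
    rw [e3, e4] at h2
    omega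
  -- to `ℚ`
  have hsum : 2 * ∑ u ∈ Finset.range 5, (p0 + 4).choose u ≤ 2 ^ (p0 + 4) := by
    have := sum_Ioo_choose_add_four p0 hp0
    omega
  have hphiNumQ : (phiNum : ℚ) = 2 ^ (p0 + 4) - 2 * ∑ u ∈ Finset.range 5, ((p0 + 4).choose u : ℚ) := by
    rw [hphiNum, Nat.cast_sub hsum]
    push_cast
    ring
  have hΦ := phiK_four_mul_choose_eq p0 hp0
  rw [← hphiNumQ] at hΦ
  have hDenPos : (0 : ℚ) < (phiDen : ℚ) := by
    rw [hphiDen]; exact_mod_cast Nat.choose_pos (by omega)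
  have hchainQ : (phiNum : ℚ) * (7560 * (T : ℚ)) + (phiDen : ℚ) * (7560 * (B : ℚ)) ≤
      (phiDen : ℚ) * (7560 * (Y : ℚ)) + (phiDen : ℚ) * (7560 * (A : ℚ)) := by
    have h : ((phiNum * (7560 * T) + phiDen * (7560 * B) : ℕ) : ℚ) ≤
        ((phiDen * (7560 * Y) + phiDen * (7560 * A) : ℕ) : ℚ) := by exact_mod_cast hchain
    push_cast at h
    linarith
  have hkey : (phiK p0 4 * (T : ℚ) + (B : ℚ)) * (phiDen : ℚ) ≤ ((Y : ℚ) + (A : ℚ)) * (phiDen : ℚ) := by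
    have e : (phiK p0 4 * (T : ℚ) + (B : ℚ)) * (phiDen : ℚ) =
        (phiK p0 4 * (phiDen : ℚ)) * (T : ℚ) + (phiDen : ℚ) * (B : ℚ) := by ring
    rw [e, hphiDen, hΦ, ← hphiDen]
    nlinarith [hchainQ]
  exact le_of_mul_le_mul_right hkey hDenPos


end S1

end PercRepro
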